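import Summits.Ventures.AbcSig.Conjectures.LevelRaising32L2Instance313Ext23
import Summits.Ventures.AbcSig.Rows.TemplateC2a

/-!
# Venture AbcSig — the SOLUTION-SIDE (Diophantine) face of the open instance `(313; 23)` of `CONJ_LR32_L2`

HONEST FRAMING. Kernel bookkeeping of the computation cell `pub-abcsig` (HOME = run/shared/lean/pub/pub-abcsig/). Every kernel reading
of the instance `Q(313; 23)` so far is CONJECTURE-side (`CONJ_LR32_L2At M 313 ↔` a typed residual: «survivors of sieve + Kraus are
Frey-congruent to a solution», p525413 … p557859), while the SOLUTION-side rows of record for `xⁿ + 313^m·yⁿ = z²` (`Rows/C2aL313A0xyodd.lean`,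
`…K.lean`) EXCLUDE `n = 23` wholesale (`hres : n ∉ [23]`): before this file the kernel said nothing about `x²³ + 313^m·y²³ = z²`. This file
states that Diophantine face INSIDE THE CELL'S CONDITIONAL FRAMEWORK, exactly as the K-rows do — CITED `NewformModel.BS04Package` (`hP`:
[BS04, Lemma 3.3 + (3.1) + Lemma 4.2]: modularity, irreducibility, level lowering), CITED `NewformModel.FreyTracePackage` (`hT`: [BS04, (3.1),
p. 27, Prop. 4.3]), COMPUTED `DataComplete 10016` / `RefinesCPSymAll 10016` (`hD`, `hCP`: the certified level file `Levels/N10016.lean`) and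
the COMPUTED same-newforms hypothesis `hX` of p525413; TYPED hypotheses (`HS313`, `HS223`, `HI2Cells`, `HP23`, and the computed `hX223`)
appear only in the theorems that name them. Nothing is unconditional except §1; typed ≠ proved; computed ≠ proved; NOTHING decides
`Q313Dioph`; kernel face of `CONJ_LR32_L2` UNCHANGED (62 proved + 1 reduced + 1 out of scope / 64); no row of the (frozen) paper is added
or altered — §3 is a kernel NOTE adjacent to the row of record; nothing about ABC or any summit. MEANINGFUL ONLY FOR THE INTENDED MODEL.

CONTENT.
* §1 (UNCONDITIONAL) `313^m ± 1` is never a square (`m ≥ 1`); hence `no_pseudo_313`: a primitive solution of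
  `x²³ + 313^m·y²³ = z²` is never a pseudo-solution — the rows' `xy ≠ ±1` premises are DISCHARGED at `ℓ = 313`.
* §2 `sol313_frey_congruent` (hP, hT, hD, hCP — no `hX`): every primitive solution with `xy` odd, `1 ≤ m ≤ 22`, normalises ([BS04]
  case (i), `case_i_or_swap`) to an `E₁` datum `S` (`LR32E1Datum S m`) carrying a newform `f` of level `2⁵·313` with `M.Arises`,
  `M.Matches f orbit_10016_1` (the eight other orbits of the level are refuted at `n = 23` by the norm-form certificates already used in
  p525413's slice proof) and `CongruentToFrey M f 23 .E1 S` — the DUAL of the residual («solutions give survivors»).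
* §3 `sol313_class` (+ hX, by p553846's `lr32_E1_class_forced'`): such a solution has `m ∈ {6, 10, 13, 17}`; contrapositively the
  PARTIAL ROW `xrow_C2aL313A0xyodd_n23`: for the 18 exponents `m ∈ {1, …, 22} ∖ {6, 10, 13, 17}` there is NO primitive solution with
  `xy` odd (both orientations, no `xy ≠ ±1` premise); `sol313_class_sympl` (+ hX223 computed, HS313/HS223 typed): `m ∈ {6, 13}`.
  §4: the booked local sentences as properties of the putative SOLUTION: `sol313_four_dvd` (HI2Cells booked ⇒ `4 ∣ z`),
  `sol313_not_canonLift23` (HP23 typed ⇒ passport class and `z mod 23²` is not the canonical-lift residue, p557859).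
* §5 the DICHOTOMY for a GLOBAL (descent / Thue–Mahler / Chabauty) pass, as TYPED EQUIVALENCES: with `Q313Dioph ms` := «`x²³ + 313^m·y²³
  = z²` has a primitive solution for some `m ∈ ms`» (any parity; exponents `≥ 23` reduce by absorbing `313^{23k}` into `y`): inside (`hX`
  computed) a proof of `¬ Q313Dioph [6, 10, 13, 17]` makes `LR32Residual313E M` — and, modulo `hD`, `hCP`, `hX`, the slice
  `CONJ_LR32_L2At M 313` — EQUIVALENT to `LR32Residual313Deg M`: the death of `10016.1` in every open class at some auxiliary prime unless a
  DEGENERATE `E₂`-labelled datum (`8 ∣ A`, outside [BS04]'s case list, let through by the typed conjecture's lax distribution clause,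
  addressed by no certificate of record yet) is congruent to it (`CONJ_LR32_L2At_313_iff_deg`; SYMPL form with `[6, 13]`); and
  `sol313_residual_witness`: an odd primitive solution realises the residual's `E₁` conclusion for ITS OWN newform of `10016.1`.
  So the kernel says what «decide Q(313; 23)» means on the solution side; which way the intended model reads it is the registrar's book.

References: [BS04] M. A. Bennett, C. M. Skinner, Canad. J. Math. 56 (2004) 23–54; A. Kraus, Canad. J. Math. 49 (1997) 1139–1161. Cell
records: HOME/STRUCTURE.md §6 CONJ-LR32 / §8 (313; 23) (NEGATIVE-21, v3.29–v3.40), HOME/lead/CONJ-LEAN-SPEC.md l.44–l.51, HOME/plean/g19…g25.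
-/

namespace Summit.Ventures.AbcSig.Conjectures

open Summit.Ventures.AbcSig

/-! ## §1 No pseudo-solutions at `ℓ = 313` (unconditional) -/

/-- `313^m + 1` is not a square (`313 ≡ 1 (mod 3)`, so `313^m + 1 ≡ 2`, a non-residue mod 3). -/
theorem sq_ne_pow313_add_one (m : ℕ) (z : ℤ) : z ^ 2 ≠ 313 ^ m + 1 := by
  intro h
  have h3 := congrArg (Int.cast : ℤ → ZMod 3) h
  push_cast at h3
  rw [show (313 : ZMod 3) = 1 by decide, one_pow] at h3
  generalize (z : ZMod 3) = w at h3
  revert w; decide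

/-- `313^m − 1` is not a square for `m ≥ 1`: for `m` odd `313^m ≡ 9 (mod 16)` while `z² + 1 ∈ {1, 2, 5, 10} (mod 16)`; for `m = 2k ≥ 2`,
`(313^k − z)(313^k + z) = 1` forces `313^k = ±1`. -/
theorem sq_add_one_ne_pow313 (m : ℕ) (hm : 1 ≤ m) (z : ℤ) : z ^ 2 + 1 ≠ 313 ^ m := by
  intro h
  obtain ⟨k, rfl | rfl⟩ := Nat.even_or_odd' m
  · have hk : k ≠ 0 := by rintro rfl; omega
    have hmul : ((313 : ℤ) ^ k - z) * (313 ^ k + z) = 1 := by rw [pow_mul'] at h; linear_combination -h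
    have hge : (313 : ℤ) ≤ 313 ^ k := le_self_pow₀ (by norm_num) hk
    rcases Int.mul_eq_one_iff_eq_one_or_neg_one.mp hmul with ⟨h1, h2⟩ | ⟨h1, h2⟩ <;> linarith
  · have h16 := congrArg (Int.cast : ℤ → ZMod 16) h
    push_cast at h16
    have h9 : (313 : ZMod 16) ^ (2 * k + 1) = 9 := by
      rw [pow_succ, pow_mul, show (313 : ZMod 16) ^ 2 = 1 by decide, one_pow, one_mul]; decide
    rw [h9] at h16
    generalize (z : ZMod 16) = w at h16
    revert w; decide

/-- **No pseudo-solution at `ℓ = 313`**: a primitive solution of `x²³ + 313^m·y²³ = z²` (`m ≥ 1`) has `xy ≠ ±1` — the four sign patterns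
give `z² = 313^m + 1`, `z² = −313^m − 1 < 0`, `z² = 1 − 313^m < 0`, `z² + 1 = 313^m`, all impossible. -/
theorem no_pseudo_313 {m : ℕ} (hm : 1 ≤ m) {x y z : ℤ} (h : IsPrimitiveSolution 1 (313 ^ m) 1 23 x y z) :
    x * y ≠ 1 ∧ x * y ≠ -1 := by
  obtain ⟨heq, -, -, -, -, -, -⟩ := h
  push_cast at heq
  have hpos : (313 : ℤ) ≤ 313 ^ m := le_self_pow₀ (by norm_num) (by omega)
  have hz : 0 ≤ z ^ 2 := sq_nonneg z
  constructor
  · intro hxy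
    rcases Int.mul_eq_one_iff_eq_one_or_neg_one.mp hxy with ⟨rfl, rfl⟩ | ⟨rfl, rfl⟩
    · exact sq_ne_pow313_add_one m z (by linear_combination -heq)
    · norm_num at heq; linarith
  · intro hxy
    rcases Int.mul_eq_neg_one_iff_eq_one_or_neg_one.mp hxy with ⟨rfl, rfl⟩ | ⟨rfl, rfl⟩
    · norm_num at heq; linarith
    · exact sq_add_one_ne_pow313 m hm z (by norm_num at heq; linear_combination -heq)

/-! ## §2 Inside (H): a solution gives a newform of `10016.1` congruent to its Frey curve -/

/-- The core step for a STANDING datum in case (i) at level `2⁵·313`: [BS04, Lemma 3.3] (`hP`) gives a newform `f` with `M.Arises`, the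
trace package (`hT`) makes `f` congruent above `23` to `E₁(S)`, and `f` matches `10016.1` because the eight other orbits of
`Levels/N10016.lean` are refuted at `n = 23` by their norm-form certificates (`cp_10016_k_check`, bases `< 17`, `23 ∉ R₃₂(313)`). -/
theorem sol313_core (M : NewformModel) (hP : M.BS04Package) (hT : M.FreyTracePackage)
    (hD : M.DataComplete 10016 level10016Orbits) (hCP : M.RefinesCPSymAll 10016 level10016CP)
    (S : FreyDatum) (hS : Standing S .i) (hn : S.n = 23) (hL : bs04Level .i S.A S.B S.C S.n = 2 ^ 5 * 313)
    (hO : bs04OddLevel S.A S.B S.C S.n ∣ 2 ^ 5 * 313) :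
    ∃ f : M.Form (2 ^ 5 * 313), M.Arises S (2 ^ 5 * 313) f ∧ M.Matches f orbit_10016_1 ∧ CongruentToFrey M f 23 .E1 S := by
  have hn23 : Nat.Prime 23 := by norm_num
  obtain ⟨hA, hB, hC, hsq, hnp, h7, hndvd, hfree, hsol, hab1, hab2, hcase⟩ := hS
  obtain ⟨hlev, hmod⟩ := hP S .i hA hB hC hsq hnp h7 hndvd hfree hsol hab1 hab2 hcase
  obtain ⟨f, hf⟩ := hlev _ hL
  have hcong : CongruentToFrey M f 23 .E1 S := by
    have h := congruentToFrey_of_freyTracePackage hT S .i ⟨hA, hB, hC, hsq, hnp, h7, hndvd, hfree, hsol, hab1, hab2, hcase⟩ _ hO f hf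
    rw [hn] at h; exact h
  refine ⟨f, hf, ?_, hcong⟩
  have hmod23 : M.ArisesMod f 23 bs04Allowed := by have h := hmod _ f hf; rw [hn] at h; exact h
  obtain ⟨o, ho, hfo⟩ := hD f
  simp only [level10016Orbits, List.mem_cons, List.not_mem_nil, or_false] at ho
  rcases ho with rfl | rfl | rfl | rfl | rfl | rfl | rfl | rfl | rfl
  · exact hfo
  · exact absurd hmod23 (not_arisesMod_of_cpCheck_lr M a32_val_313 _ _ _ cp_10016_2_check (by norm_num)
      (hCP.of_mem (by simp [level10016CP])) hn23 (by norm_num) (by norm_num) not_levelRaise_313_23 (by decide +kernel) f hfo)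
  · exact absurd hmod23 (not_arisesMod_of_cpCheck_lr M a32_val_313 _ _ _ cp_10016_3_check (by norm_num)
      (hCP.of_mem (by simp [level10016CP])) hn23 (by norm_num) (by norm_num) not_levelRaise_313_23 (by decide +kernel) f hfo)
  · exact absurd hmod23 (not_arisesMod_of_cpCheck_lr M a32_val_313 _ _ _ cp_10016_4_check (by norm_num)
      (hCP.of_mem (by simp [level10016CP])) hn23 (by norm_num) (by norm_num) not_levelRaise_313_23 (by decide +kernel) f hfo)
  · exact absurd hmod23 (not_arisesMod_of_cpCheck_lr M a32_val_313 _ _ _ cp_10016_5_check (by norm_num)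
      (hCP.of_mem (by simp [level10016CP])) hn23 (by norm_num) (by norm_num) not_levelRaise_313_23 (by decide +kernel) f hfo)
  · exact absurd hmod23 (not_arisesMod_of_cpCheck_lr M a32_val_313 _ _ _ cp_10016_6_check (by norm_num)
      (hCP.of_mem (by simp [level10016CP])) hn23 (by norm_num) (by norm_num) not_levelRaise_313_23 (by decide +kernel) f hfo)
  · exact absurd hmod23 (not_arisesMod_of_cpCheck_lr M a32_val_313 _ _ _ cp_10016_7_check (by norm_num)
      (hCP.of_mem (by simp [level10016CP])) hn23 (by norm_num) (by norm_num) not_levelRaise_313_23 (by decide +kernel) f hfo)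
  · exact absurd hmod23 (not_arisesMod_of_cpCheck_lr M a32_val_313 _ _ _ cp_10016_8_check (by norm_num)
      (hCP.of_mem (by simp [level10016CP])) hn23 (by norm_num) (by norm_num) not_levelRaise_313_23 (by decide +kernel) f hfo)
  · exact absurd hmod23 (not_arisesMod_of_cpCheck_lr M a32_val_313 _ _ _ cp_10016_9_check (by norm_num)
      (hCP.of_mem (by simp [level10016CP])) hn23 (by norm_num) (by norm_num) not_levelRaise_313_23 (by decide +kernel) f hfo)

/-- **Inside (H): every primitive solution of `x²³ + 313^m·y²³ = z²` with `xy` odd (`1 ≤ m ≤ 22`) gives a newform of `10016.1` congruent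
above `23` to the Frey curve `E₁` of its [BS04]-normalised datum** — the datum is `(1, 313^m, 1; 23; x, y, z)` or the swap
`(313^m, 1, 1; 23; y, x, z)` (whichever is in case (i): `b ≡ −BC (mod 4)`), it is an `LR32E1Datum` of exponent class `m`, and `f` has
`M.Arises`, `M.Matches f orbit_10016_1`, `CongruentToFrey M f 23 .E1 S`. Hypotheses: `hP`, `hT` CITED; `hD`, `hCP` COMPUTED; no `hX`. -/
theorem sol313_frey_congruent (M : NewformModel) (hP : M.BS04Package) (hT : M.FreyTracePackage)
    (hD : M.DataComplete 10016 level10016Orbits) (hCP : M.RefinesCPSymAll 10016 level10016CP)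
    (m : ℕ) (hm : 1 ≤ m) (hm23 : m < 23) (x y z : ℤ) (hxy : ¬ 2 ∣ x * y) (hsol : IsPrimitiveSolution 1 (313 ^ m) 1 23 x y z) :
    ∃ (S : FreyDatum) (f : M.Form (2 ^ 5 * 313)),
      (S = ⟨1, 313 ^ m, 1, 23, x, y, z⟩ ∨ S = ⟨313 ^ m, 1, 1, 23, y, x, z⟩) ∧
      FreyCase.i.Holds S.A S.B S.C S.n S.a S.b S.c ∧ LR32E1Datum S m ∧
      M.Arises S (2 ^ 5 * 313) f ∧ M.Matches f orbit_10016_1 ∧ CongruentToFrey M f 23 .E1 S := by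
  have h313 : Nat.Prime 313 := by norm_num
  have hn23 : Nat.Prime 23 := by norm_num
  obtain ⟨hxy1, hxy2⟩ := no_pseudo_313 hm hsol
  have hodd5 : ¬ 2 ∣ x * y * (1 : ℕ) * (313 ^ m : ℕ) * (1 : ℕ) := by
    intro h
    have h' : (2 : ℤ) ∣ x * y * 313 ^ m := by simpa using h
    rcases Int.prime_two.dvd_mul.mp h' with h2 | h2
    · exact hxy h2
    · exact prime_odd_int 313 h313 (by norm_num) (Int.prime_two.dvd_of_dvd_pow h2)
  have hfreeB : ∀ q : ℕ, q.Prime → ¬ q ^ 23 ∣ 313 ^ m := fun q hq => by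
    simpa using nthPowerFree_twoPow_primePow 313 0 m 23 h313 (by norm_num) (by norm_num) hm23 q hq
  have hfree1 := nthPowerFree_one (313 ^ m) 23 (by norm_num) hfreeB
  have hn313 : ¬ 23 ∣ 313 ^ m := by simpa using not_dvd_twoPow_primePow 313 0 m 23 h313 hn23 (by norm_num) (by norm_num)
  obtain ⟨-, -, -, -, -, -, -, hL32, hL32', -⟩ := levelsC2a 313 h313 (by norm_num) 23 (by norm_num) 0 m hm
  obtain ⟨hO, hO'⟩ := bs04OddLevel_twoPow_primePow 313 0 m 23 h313 (by norm_num) hm (by norm_num)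
  simp only [pow_zero, one_mul] at hL32 hL32' hO hO'
  have hBpos : 0 < 313 ^ m := pow_pos (by norm_num) m
  rcases case_i_or_swap hsol (by decide : Odd 23) hodd5 with hcase | hcase
  · -- the datum `(1, 313^m, 1; 23; x, y, z)` is in case (i)
    have hS : Standing ⟨1, 313 ^ m, 1, 23, x, y, z⟩ .i :=
      ⟨one_pos, hBpos, one_pos, squarefree_one, hn23, by norm_num, by simpa using hn313, hfree1, hsol, hxy1, hxy2, hcase⟩
    obtain ⟨f, hf, hfo, hcong⟩ := sol313_core M hP hT hD hCP _ hS rfl (hL32.trans (by norm_num))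
      (by rw [hO]; exact Dvd.intro_left _ rfl)
    exact ⟨_, f, Or.inl rfl, hcase, ⟨rfl, rfl, hm, Nat.coprime_one_left _, hsol, one_mul _⟩, hf, hfo, hcong⟩
  · -- the swapped datum `(313^m, 1, 1; 23; y, x, z)` is in case (i)
    have hS : Standing ⟨313 ^ m, 1, 1, 23, y, x, z⟩ .i :=
      ⟨hBpos, one_pos, one_pos, squarefree_one, hn23, by norm_num, by simpa using hn313,
        fun q hq => ⟨(hfree1 q hq).2, (hfree1 q hq).1⟩, hsol.swap, by rw [mul_comm]; exact hxy1,
        by rw [mul_comm]; exact hxy2, hcase⟩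
    obtain ⟨f, hf, hfo, hcong⟩ := sol313_core M hP hT hD hCP _ hS rfl (hL32'.trans (by norm_num))
      (by rw [hO']; exact Dvd.intro_left _ rfl)
    exact ⟨_, f, Or.inr rfl, hcase, ⟨rfl, rfl, hm, Nat.coprime_one_right _, hsol.swap, mul_one _⟩, hf, hfo, hcong⟩

/-! ## §3 The exponent class of a solution; the partial row at `n = 23` -/

/-- **Inside (H) + `hX`: a primitive solution of `x²³ + 313^m·y²³ = z²` with `xy` odd and `1 ≤ m ≤ 22` has `m ∈ {6, 10, 13, 17}`**
(`m ≡ ±6, ±10 (mod 23)` = NEGATIVE-21's open classes) — §2 and p553846's class forcing `lr32_E1_class_forced'` (the 74 + 2 + 4 + 2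
Kraus-table certificates of record against the datum `lr32X313`). -/
theorem sol313_class (M : NewformModel) (hP : M.BS04Package) (hT : M.FreyTracePackage)
    (hD : M.DataComplete 10016 level10016Orbits) (hCP : M.RefinesCPSymAll 10016 level10016CP)
    (hX : ∀ f : M.Form (2 ^ 5 * 313), M.Matches f orbit_10016_1 → M.Matches f lr32X313)
    (m : ℕ) (hm : 1 ≤ m) (hm23 : m < 23) (x y z : ℤ) (hxy : ¬ 2 ∣ x * y) (hsol : IsPrimitiveSolution 1 (313 ^ m) 1 23 x y z) :
    m = 6 ∨ m = 10 ∨ m = 13 ∨ m = 17 := by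
  obtain ⟨S, f, -, -, hdat, -, hfo, hcong⟩ := sol313_frey_congruent M hP hT hD hCP m hm hm23 x y z hxy hsol
  have heq := hdat.eqn
  obtain ⟨hn, hC, -, hco, -, hAB⟩ := hdat
  have h := lr32_E1_class_forced' M f (hX f hfo) S m hn hC hco hAB heq hcong
  have hmod : m % 23 = m := Nat.mod_eq_of_lt hm23
  omega

/-- **PARTIAL ROW at the residual exponent `n = 23` (kernel note adjacent to the row of record `C2aL313A0xyodd`, whose statement excludes
`n = 23`).** Inside (H) (`hP`, `hT` CITED) with `hD`, `hCP`, `hX` COMPUTED: for the EIGHTEEN exponents `m ∈ {1, …, 22} ∖ {6, 10, 13, 17}`,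
`x²³ + 313^m·y²³ = z²` has NO primitive solution with `xy` odd (both orientations — the statement is symmetric under
`IsPrimitiveSolution.swap`; no `xy ≠ ±1` premise, §1). The four classes `m ∈ {6, 10, 13, 17}` are the OPEN instance `Q(313; 23)`. -/
theorem xrow_C2aL313A0xyodd_n23 (M : NewformModel) (hP : M.BS04Package) (hT : M.FreyTracePackage)
    (hD : M.DataComplete 10016 level10016Orbits) (hCP : M.RefinesCPSymAll 10016 level10016CP)
    (hX : ∀ f : M.Form (2 ^ 5 * 313), M.Matches f orbit_10016_1 → M.Matches f lr32X313)
    (m : ℕ) (hm : 1 ≤ m) (hm23 : m < 23) (h6 : m ≠ 6) (h10 : m ≠ 10) (h13 : m ≠ 13) (h17 : m ≠ 17)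
    (x y z : ℤ) (hxy : ¬ 2 ∣ x * y) : ¬ IsPrimitiveSolution 1 (313 ^ m) 1 23 x y z := fun hsol => by
  rcases sol313_class M hP hT hD hCP hX m hm hm23 x y z hxy hsol with h | h | h | h <;> omega

/-- **With the SYMPL inputs (v3.29): `m ∈ {6, 13}`** (`= {6, −10} (mod 23)`) — §2 and p553846's `lr32_sympl_class`, modulo the COMPUTED
matching datum `hX223` (`c₂₂₃(10016.1)`) and the TYPED local symplectic criteria `HS313` (multiplicative place 313, [KO92 Prop. 2 = FK16
Thm 13], Frey inputs proved in p543565) and `HS223` (the 223 datum). Typed ≠ proved. -/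
theorem sol313_class_sympl (M : NewformModel) (hP : M.BS04Package) (hT : M.FreyTracePackage)
    (hD : M.DataComplete 10016 level10016Orbits) (hCP : M.RefinesCPSymAll 10016 level10016CP)
    (hX : ∀ f : M.Form (2 ^ 5 * 313), M.Matches f orbit_10016_1 → M.Matches f lr32X313)
    (hX223 : ∀ f : M.Form (2 ^ 5 * 313), M.Matches f orbit_10016_1 → M.Matches f lr32X313c)
    (ε : FreyDatum → ℤ) (h313 : HS313 M ε) (h223 : HS223 M ε)
    (m : ℕ) (hm : 1 ≤ m) (hm23 : m < 23) (x y z : ℤ) (hxy : ¬ 2 ∣ x * y) (hsol : IsPrimitiveSolution 1 (313 ^ m) 1 23 x y z) :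
    m = 6 ∨ m = 13 := by
  obtain ⟨S, f, -, -, hdat, -, hfo, hcong⟩ := sol313_frey_congruent M hP hT hD hCP m hm hm23 x y z hxy hsol
  have h := lr32_sympl_class M ε h313 h223 hX hX223 f hfo S m hdat hcong
  have hmod : m % 23 = m := Nat.mod_eq_of_lt hm23
  omega

/-! ## §4 The booked local sentences as properties of the putative solution -/

/-- **`4 ∣ z`** for every primitive solution with `xy` odd (`1 ≤ m ≤ 22`), modulo the BOOKED `(1+i)` cell hypothesis `HI2Cells M
inertia2CellsBooked` of p551031 (v3.33/v3.34: two-handed certified computations inside ((H), (H_id)), TYPED as a computed hypothesis)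
— via `HI2_of_cellsBooked` and `mem_inertia2Booked_iff` on the normalised datum (whose `c` is `z` in both orientations). -/
theorem sol313_four_dvd (M : NewformModel) (hP : M.BS04Package) (hT : M.FreyTracePackage)
    (hD : M.DataComplete 10016 level10016Orbits) (hCP : M.RefinesCPSymAll 10016 level10016CP)
    (h𝒯 : HI2Cells M inertia2CellsBooked)
    (m : ℕ) (hm : 1 ≤ m) (hm23 : m < 23) (x y z : ℤ) (hxy : ¬ 2 ∣ x * y) (hsol : IsPrimitiveSolution 1 (313 ^ m) 1 23 x y z) :
    (4 : ℤ) ∣ z := by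
  obtain ⟨S, f, hS, hcase, hdat, -, hfo, hcong⟩ := sol313_frey_congruent M hP hT hD hCP m hm hm23 x y z hxy hsol
  have hz : S.c = z := by rcases hS with rfl | rfl <;> rfl
  have hz0 : z ≠ 0 := by obtain ⟨-, -, -, hc, -, -, -⟩ := hsol; simpa using hc
  have h := HI2_of_cellsBooked M h𝒯 f hfo S m hdat hcase hcong
  rw [hz] at h
  exact (mem_inertia2Booked_iff z hz0).mp h

/-- **At the residual place `23`** (modulo the TYPED trace passport `HP23` of p557859 and the SYMPL inputs): the normalised datum `S` of a
primitive solution with `xy` odd lies in a passport class and **`z mod 23²` is NOT the canonical-lift residue of its class** — p557859's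
PROVED `frey_not_canonLift23` (referee F1/F1′) applied to the solution; `S.c = z` in both orientations. -/
theorem sol313_not_canonLift23 (M : NewformModel) (hP : M.BS04Package) (hT : M.FreyTracePackage)
    (hD : M.DataComplete 10016 level10016Orbits) (hCP : M.RefinesCPSymAll 10016 level10016CP)
    (hX : ∀ f : M.Form (2 ^ 5 * 313), M.Matches f orbit_10016_1 → M.Matches f lr32X313)
    (hX223 : ∀ f : M.Form (2 ^ 5 * 313), M.Matches f orbit_10016_1 → M.Matches f lr32X313c)
    (ε : FreyDatum → ℤ) (h313 : HS313 M ε) (h223 : HS223 M ε) (hP23 : HP23 M)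
    (m : ℕ) (hm : 1 ≤ m) (hm23 : m < 23) (x y z : ℤ) (hxy : ¬ 2 ∣ x * y) (hsol : IsPrimitiveSolution 1 (313 ^ m) 1 23 x y z) :
    ∃ S : FreyDatum, (S = ⟨1, 313 ^ m, 1, 23, x, y, z⟩ ∨ S = ⟨313 ^ m, 1, 1, 23, y, x, z⟩) ∧
      adm23 (z : ZMod 23) (e1v23 S) = true ∧ (z : ZMod 529) ≠ canonLift23 (e1v529 S) (z : ZMod 23) := by
  obtain ⟨S, f, hS, -, hdat, -, hfo, hcong⟩ := sol313_frey_congruent M hP hT hD hCP m hm hm23 x y z hxy hsol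
  have hz : S.c = z := by rcases hS with rfl | rfl <;> rfl
  have hadm := hP23 f hfo S m hdat hcong
  have hr := lr32_sympl_class M ε h313 h223 hX hX223 f hfo S m hdat hcong
  have heq := hdat.eqn
  obtain ⟨hn, hC, -, hco, -, hAB⟩ := hdat
  have h := frey_not_canonLift23 S m hn hC hco hAB heq hr hadm
  rw [hz] at hadm h
  exact ⟨S, hS, hadm, h⟩

/-! ## §5 The dichotomy for a GLOBAL pass: Diophantine non-existence ⇒ only the degenerate branch of the residual survives -/

/-- **Reduction of the exponent**: a primitive solution of `x²³ + 313^(23k + r)·y²³ = z²` is a primitive solution of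
`x²³ + 313^r·(313^k y)²³ = z²` (absorb `313^{23k}` into `y`; the coprimalities follow from `313^r·313^k·y ∣ 313^(23k+r)·y`). -/
theorem primitiveSolution_pow313_reduce {k r : ℕ} {a b c : ℤ} (h : IsPrimitiveSolution 1 (313 ^ (23 * k + r)) 1 23 a b c) :
    IsPrimitiveSolution 1 (313 ^ r) 1 23 a (313 ^ k * b) c := by
  obtain ⟨heq, ha, hb, hc, hab, hac, hbc⟩ := h
  have hb0 : b ≠ 0 := by rintro rfl; simp at hb
  have hdvd : ((313 ^ r : ℕ) : ℤ) * (313 ^ k * b) ∣ ((313 ^ (23 * k + r) : ℕ) : ℤ) * b := by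
    push_cast
    rw [← mul_assoc, ← pow_add]
    exact mul_dvd_mul_right (pow_dvd_pow 313 (by omega)) b
  refine ⟨?_, ha, ?_, hc, hab.of_isCoprime_of_dvd_right hdvd, hac, hbc.of_isCoprime_of_dvd_left hdvd⟩
  · rw [← heq]; push_cast; ring
  · push_cast
    exact mul_ne_zero (pow_ne_zero _ (by norm_num)) (mul_ne_zero (pow_ne_zero _ (by norm_num)) hb0)

/-- **`Q313Dioph ms` — the Diophantine face of `Q(313; 23)`**: the generalized Fermat equation `x²³ + 313^m·y²³ = z²` has a PRIMITIVE
solution ([BS04, p. 24]: `x`, `313^m y`, `z` nonzero and pairwise coprime) for some exponent `m` in the list `ms` — ANY parity of `xy`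
(the residual's conclusion carries no parity), either orientation (`IsPrimitiveSolution.swap`), exponents `≥ 23` reduced into `ms` by
`primitiveSolution_pow313_reduce`. Used with `ms = [6, 10, 13, 17]` (NEGATIVE-21's classes, forced by `hX` alone) and `ms = [6, 13]` (the
SYMPL survivors). OPEN: nothing in the tree decides it; the cell's computed search found no solution with `x, y ≤ 3000`
(HOME/STRUCTURE.md §8 (313; 23) leg (G), not in the kernel). -/
def Q313Dioph (ms : List ℕ) : Prop :=
  ∃ m ∈ ms, ∃ a b c : ℤ, IsPrimitiveSolution 1 (313 ^ m) 1 23 a b c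

/-- An odd primitive solution with `1 ≤ m ≤ 22` witnesses `Q313Dioph [6, 10, 13, 17]` inside (H) + `hX` (§3 places its exponent). -/
theorem q313Dioph_of_odd_solution (M : NewformModel) (hP : M.BS04Package) (hT : M.FreyTracePackage)
    (hD : M.DataComplete 10016 level10016Orbits) (hCP : M.RefinesCPSymAll 10016 level10016CP)
    (hX : ∀ f : M.Form (2 ^ 5 * 313), M.Matches f orbit_10016_1 → M.Matches f lr32X313)
    (m : ℕ) (hm : 1 ≤ m) (hm23 : m < 23) (x y z : ℤ) (hxy : ¬ 2 ∣ x * y) (hsol : IsPrimitiveSolution 1 (313 ^ m) 1 23 x y z) :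
    Q313Dioph [6, 10, 13, 17] :=
  ⟨m, by simpa using sol313_class M hP hT hD hCP hX m hm hm23 x y z hxy hsol, x, y, z, hsol⟩

/-- **An `E₁` datum of the residual's conclusion witnesses `Q313Dioph ms` as soon as its exponent class `m mod 23` lies in `ms`**: by
`dist313` the datum is `(1, 313^m)` or `(313^m, 1)` (swap), and `313^{23⌊m/23⌋}` is absorbed into `y`. No parity is needed or claimed. -/
theorem q313Dioph_of_datum {ms : List ℕ} (S : FreyDatum) (m : ℕ) (hco : Nat.Coprime S.A S.B)
    (hsol : IsPrimitiveSolution S.A S.B 1 23 S.a S.b S.c) (hAB : S.A * S.B = 313 ^ m) (hr : m % 23 ∈ ms) : Q313Dioph ms := by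
  obtain ⟨k, r, hrm, rfl⟩ : ∃ k r, r = m % 23 ∧ m = 23 * k + r := ⟨m / 23, m % 23, rfl, (Nat.div_add_mod m 23).symm⟩
  rw [← hrm] at hr
  rcases dist313 S.A S.B _ hco hAB with ⟨hA, hB⟩ | ⟨hA, hB⟩
  · have h := hsol.swap
    rw [hA, hB] at h
    exact ⟨r, hr, _, _, _, primitiveSolution_pow313_reduce h⟩
  · have h := hsol
    rw [hA, hB] at h
    exact ⟨r, hr, _, _, _, primitiveSolution_pow313_reduce h⟩

/-- **`LR32Residual313Deg M` — the DEGENERATE branch of the residual, alone.** VERBATIM `LR32Residual313Forced M 𝒯` (p553846) / `LR32Residual313E M`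
(p539869) with the conclusion cut down to its `E₂`-labelled disjunct with `8 ∣ A`: data `(A, B)` with `A·B = 2³·313^m`, `8 ∣ A` — OUTSIDE
[BS04]'s case list (case (iv) has `ord₂ B = 3`), on which `freyTrace .E2` is not the trace of the datum's printed Frey curve; let through by
the typed conjecture's lax distribution clause (design note D4/(iii) of `Conjectures/LevelRaising32L2.lean`) and addressed by no certificate
of record (p553846's `lr32_E2_excluded` removes only the two normalised distributions). An HYPOTHESIS-shaped Prop; nothing decides it here. -/
def LR32Residual313Deg (M : NewformModel) : Prop :=
  ∀ f : M.Form (2 ^ 5 * 313), M.Matches f orbit_10016_1 → ∀ κ ∈ lr32Residual313ClassesE,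
    M.ArisesMod f 23 (lr32ClassAllowed 313 23 κ) →
      ∃ (S : FreyDatum) (m : ℕ), S.n = 23 ∧ S.C = 1 ∧ 1 ≤ m ∧ Nat.Coprime S.A S.B ∧
        IsPrimitiveSolution S.A S.B 1 23 S.a S.b S.c ∧ S.A * S.B = 2 ^ 3 * 313 ^ m ∧ 8 ∣ S.A ∧ CongruentToFrey M f 23 .E2 S

/-- The degenerate branch implies the forced residual (it is one of its disjuncts), for every cell set `𝒯`. -/
theorem LR32Residual313Forced_of_deg (M : NewformModel) (𝒯 : Set (ℕ × ZMod 16)) (h : LR32Residual313Deg M) :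
    LR32Residual313Forced M 𝒯 := fun f hf κ hκ hA => by
  obtain ⟨S, m, hn, hC, hm, hco, hsol, hE₂⟩ := h f hf κ hκ hA; exact ⟨S, m, hn, hC, hm, hco, hsol, Or.inr hE₂⟩

/-- The degenerate branch implies the eight-class residual `LR32Residual313E M`. -/
theorem LR32Residual313E_of_deg (M : NewformModel) (h : LR32Residual313Deg M) : LR32Residual313E M :=
  LR32Residual313E_of_forced M Set.univ (LR32Residual313Forced_of_deg M _ h)

/-- **Diophantine non-existence on the four classes cuts the eight-class residual down to its degenerate branch** (modulo `hX` only): an `E₁`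
witness would have `m mod 23 ∈ {6, 10, 13, 17}` by class forcing (`lr32_E1_class_forced'`) and reduce to a solution counted by
`Q313Dioph [6, 10, 13, 17]`; a normalised `E₂` witness is excluded by `lr32_E2_excluded`; what remains is `8 ∣ A` (`dist8_313`). -/
theorem LR32Residual313Deg_of_E (M : NewformModel)
    (hX : ∀ f : M.Form (2 ^ 5 * 313), M.Matches f orbit_10016_1 → M.Matches f lr32X313)
    (hnD : ¬ Q313Dioph [6, 10, 13, 17]) (h : LR32Residual313E M) : LR32Residual313Deg M := by
  intro f hf κ hκ hA
  obtain ⟨S, m, hn, hC, hm, hco, hsol, hbr⟩ := h f hf κ hκ hA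
  have heq : (S.A : ℤ) * S.a ^ S.n + S.B * S.b ^ S.n = S.C * S.c ^ 2 := by rw [hn, hC]; exact hsol.1
  rcases hbr with ⟨hAB, hcong⟩ | ⟨hAB, hcong⟩
  · refine absurd (q313Dioph_of_datum S m hco hsol hAB ?_) hnD
    have hr := lr32_E1_class_forced' M f (hX f hf) S m hn hC hco hAB heq hcong
    simpa using hr
  · refine ⟨S, m, hn, hC, hm, hco, hsol, hAB, ?_, hcong⟩
    rcases dist8_313 S.A S.B m hco (by simpa using hAB) with hd | hd | h8
    · exact (lr32_E2_excluded M f (hX f hf) S m hn hC (Or.inl hd) heq hcong).elim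
    · exact (lr32_E2_excluded M f (hX f hf) S m hn hC (Or.inr hd) heq hcong).elim
    · exact h8

/-- **Diophantine non-existence on the two SYMPL classes cuts the FORCED residual down to its degenerate branch** (no hypothesis at all: the
forced residual's `E₁` branch already carries `m mod 23 ∈ {6, 13}`). -/
theorem LR32Residual313Deg_of_forced (M : NewformModel) (𝒯 : Set (ℕ × ZMod 16)) (hnD : ¬ Q313Dioph [6, 13])
    (h : LR32Residual313Forced M 𝒯) : LR32Residual313Deg M := by
  intro f hf κ hκ hA
  obtain ⟨S, m, hn, hC, hm, hco, hsol, hbr⟩ := h f hf κ hκ hA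
  rcases hbr with ⟨hAB, -, hr, -⟩ | ⟨hAB, h8, hcong⟩
  · exact absurd (q313Dioph_of_datum S m hco hsol hAB (by simpa using hr)) hnD
  · exact ⟨S, m, hn, hC, hm, hco, hsol, hAB, h8, hcong⟩

/-- **DICHOTOMY, eight-class form — the typed equivalence (modulo the three COMPUTED hypotheses `hD`, `hCP`, `hX` only).** Inside (`hX`
computed; (H) enters only through the slice's own reading), a proof of `¬ Q313Dioph [6, 10, 13, 17]` — «`x²³ + 313^m·y²³ = z²` has NO
primitive solution for `m ∈ {6, 10, 13, 17}`» — makes the conjecture's slice at `ℓ = 313` EQUIVALENT to `LR32Residual313Deg M`: the death of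
`10016.1` in every open class at some auxiliary prime UNLESS a degenerate `E₂`-labelled datum (`8 ∣ A`) is congruent to it. (The degenerate
classes have computable Kraus tables — by the generator 37 of the 45 reduced ones die at `q ∈ {47, 139}`, COMPUTED, not in the kernel in
this file; a certificate file can remove the clause.) What the intended model does with the right-hand side (NEGATIVE-21: `10016.1` passes
every class table to `10⁵`, computed) is evidence the registrar books, NOT a kernel fact; nothing here decides `Q313Dioph`. -/
theorem CONJ_LR32_L2At_313_iff_deg (M : NewformModel) (hD : M.DataComplete 10016 level10016Orbits)
    (hCP : M.RefinesCPSymAll 10016 level10016CP)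
    (hX : ∀ f : M.Form (2 ^ 5 * 313), M.Matches f orbit_10016_1 → M.Matches f lr32X313)
    (hnD : ¬ Q313Dioph [6, 10, 13, 17]) : CONJ_LR32_L2At M 313 ↔ LR32Residual313Deg M :=
  (CONJ_LR32_L2At_313_iff₈ M hD hCP hX).trans ⟨LR32Residual313Deg_of_E M hX hnD, LR32Residual313E_of_deg M⟩

/-- The cell schema `HI2Cells` holds trivially for the full cell set. -/
theorem HI2Cells_univ (M : NewformModel) : HI2Cells M Set.univ := fun _ _ _ _ _ _ _ => Set.mem_univ _

/-- **DICHOTOMY, SYMPL form — the typed equivalence** (modulo `hD`, `hCP`, `hX`, `hX223` COMPUTED and `HS313`, `HS223` TYPED — the hypotheses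
of p553846's `CONJ_LR32_L2At_313_iff_forced` at `𝒯 = Set.univ`): a proof of `¬ Q313Dioph [6, 13]` makes the slice at `ℓ = 313` equivalent to
the degenerate branch `LR32Residual313Deg M`. Typed ≠ proved; computed ≠ proved; nothing decides `Q313Dioph`. -/
theorem CONJ_LR32_L2At_313_iff_deg_sympl (M : NewformModel) (hD : M.DataComplete 10016 level10016Orbits)
    (hCP : M.RefinesCPSymAll 10016 level10016CP)
    (hX : ∀ f : M.Form (2 ^ 5 * 313), M.Matches f orbit_10016_1 → M.Matches f lr32X313)
    (hX223 : ∀ f : M.Form (2 ^ 5 * 313), M.Matches f orbit_10016_1 → M.Matches f lr32X313c)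
    (ε : FreyDatum → ℤ) (h313 : HS313 M ε) (h223 : HS223 M ε)
    (hnD : ¬ Q313Dioph [6, 13]) : CONJ_LR32_L2At M 313 ↔ LR32Residual313Deg M :=
  (CONJ_LR32_L2At_313_iff_forced M hD hCP hX hX223 ε h313 h223 Set.univ (HI2Cells_univ M)).trans
    ⟨LR32Residual313Deg_of_forced M Set.univ hnD, LR32Residual313Forced_of_deg M Set.univ⟩

/-- **The other horn: an odd primitive solution (`1 ≤ m ≤ 22`) realises the residual's `E₁` conclusion for ITS OWN newform of `10016.1`**
(inside (H): `hP`, `hT` CITED; `hD`, `hCP` COMPUTED) — the conclusion of `LR32Residual313E M` for that `f`, verbatim, whatever class `κ` and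
premise one starts from. (For the OTHER newforms matching `10016.1` the abstract model says nothing: `CongruentToFrey` does not transfer.) -/
theorem sol313_residual_witness (M : NewformModel) (hP : M.BS04Package) (hT : M.FreyTracePackage)
    (hD : M.DataComplete 10016 level10016Orbits) (hCP : M.RefinesCPSymAll 10016 level10016CP)
    (m : ℕ) (hm : 1 ≤ m) (hm23 : m < 23) (x y z : ℤ) (hxy : ¬ 2 ∣ x * y) (hsol : IsPrimitiveSolution 1 (313 ^ m) 1 23 x y z) :
    ∃ f : M.Form (2 ^ 5 * 313), M.Matches f orbit_10016_1 ∧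
      ∃ (S : FreyDatum) (m' : ℕ), S.n = 23 ∧ S.C = 1 ∧ 1 ≤ m' ∧ Nat.Coprime S.A S.B ∧
        IsPrimitiveSolution S.A S.B 1 23 S.a S.b S.c ∧
        ((S.A * S.B = 313 ^ m' ∧ CongruentToFrey M f 23 .E1 S) ∨
          (S.A * S.B = 2 ^ 3 * 313 ^ m' ∧ CongruentToFrey M f 23 .E2 S)) := by
  obtain ⟨S, f, -, -, ⟨hn, hC, hm', hco, hps, hAB⟩, -, hfo, hcong⟩ :=
    sol313_frey_congruent M hP hT hD hCP m hm hm23 x y z hxy hsol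
  exact ⟨f, hfo, S, m, hn, hC, hm', hco, hps, Or.inl ⟨hAB, hcong⟩⟩

end Summit.Ventures.AbcSig.Conjectures
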